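import Summits.BirchSwinnertonDyer.Rank1Residual.Additive.SharpenedStatements
import Literature.NumberTheory.EllipticCurves.Fouquet2024.OrdinaryFibreRankZeroBSD
import Literature.NumberTheory.EllipticCurves.Rank1Residual.Typed.Basic
import Literature.NumberTheory.EllipticCurves.ComplexMultiplicationBurungaleFlachProofs
import Literature.NumberTheory.EllipticCurves.AnalyticRankOrderProofs
import HarnessLib

/-!
# Route `KatoDescentTamePotSupersingular` (rung K8-t′, cell `bsd-potss`): the FOUQUET-2024 ORDINARY-FIBRE road —
# L₀ and BSD_p on the (t′) rank-0 rows of ordinary residual shape at `p ≥ 5` from Fouquet, Publ. Math. Besançon 2024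
# (doi:10.5802/pmb.54) Thm 1.1 (iv)⇒(ii) + Prop. 3.9, SEED-FREE and WITHOUT Ass. 3.4
# (a `--supports … --as helper` file; items 19618 `TameLowerIntrinsicNonCM` / 19981 `TameLowerHalfRankZero`;
# seat bsd-potss-k8t-c2 g11)

WHY THIS FILE. The seed roads of this chair (`…TameLowerFouquetRoadCited{,Surj,Sigma,Nakamura}.lean`,
`…TameLowerFouquetRoadTate.lean`; p446605–p462359) consume the 2025 single-point transport (Tunisian J. Math. 7,
Thm 4.1 (1)⇒(2)): they need Fouquet's Ass. 3.4 on the tame level of `W` AND of the seed, and a DISPLAYED congruent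
good-ordinary elliptic curve `G` carrying Skinner–Urban's hypotheses. The companion paper Fouquet 2024 (Besançon,
PUBLISHED; the cell had read it — KT-SEED-SPLIT-19618-k8t-c2-g5 §4 — and set it aside as «superseded by the 2025
single-point theorem») proves the propagation over the FULL universal deformation ring `R_Σ(ρ̄)` (no Ass. 3.4, no
level compatibility) from the Λ-FIBRE of one nearly-ordinary classical point; for a residual representation with an
ordinary line and Nakamura's condition that fibre consists of good-ordinary weight-2 forms of trivial character, each
a Skinner–Urban form once `W` has a Steinberg prime `q ≢ ±1 (mod p)` with `ρ̄` ramified (readings R0–R6 of the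
Literature module `Fouquet2024/OrdinaryFibreRankZeroBSD`, p518465). This file is the kernel road over the two
composite reading facts typed there:

* §1 per pair over fact (A) `Fouquet2024.padicValRat_bsd_rank_zero_of_ordinaryFibre_ellipticShape` (the residual shape
  CERTIFIED by a displayed congruent good-ordinary `G` with `p ∤ a_p(G)² − 1`; `G` plays no other role): print shape,
  Miller's `BSDp`, both halves `MissingPPartAt`, and the crux currency `MissingLowerBoundAt`;
* §2 the ROW FORMS over (A) for the 19618 skeleton (a «FibreRowA» disjunct: `Surj W p`, a Steinberg prime
  `q ≢ ±1 (mod p)` of `W` with `p ∤ v_q(Δ_W)`, and `∃ G, GoodOrd G p ∧ p ∤ a_p(G)² − 1 ∧ [IsCongruentModP p W G unfolded]` —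
  NO `FouquetGenericAt`, NO `Assumption34TateAt` on either curve, NO `Ram G`);
* §3 per pair and row forms over fact (B) `Fouquet2024.padicValRat_bsd_rank_zero_of_ordinaryFibre` (SEED-FREE: the
  shape displayed on `W[p]|G_ℚₚ` itself as `Fouquet2024.HasOrdinaryLineNakamuraAt p W`) — the first CLASS-LEVEL,
  partner-free road on the cell `(5; II*, v₅(c₄) = 4)`.

CENSUS (this seat, kit j274275 over the 700 rank-0 rows of `(5; II*, v₅(c₄) = 4)`, `N < 5·10⁵`, memo
HOME/k8t-c2/g11/FINDING-19981-pmb2024-k8t-c2-g11.md): the `5`-division polynomial factors over `ℚ₅` as `2 + 10` on 367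
rows (Nakamura's condition HOLDS) and as `2 + 5 + 5` on 333 (FAILS); on all 347 rows with a certified good-ordinary
partner this agrees with `a₅(G) ≢ ±1` resp. `≡ ±1 (mod 5)`. Road §2 (A): 242 rows (37 of the 92 content rows
`25 ∣ #Ш_an`); road §3 (B): 276 rows (46 content), of which 34 (9 content) have NO elliptic good-ordinary partner
below `5·10⁵`. Tier A of the 2025 road (p452337/p462359): 203 rows (38 content); 42 of them have only Steinberg
primes `q ≡ ±1 (mod 5)` and are NOT on the new roads.

HONEST FRAMING: conditional on cite-level reading facts (no `_holds`: `R = T`, Nakamura's zeta morphism,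
Skinner–Urban's Eisenstein congruences are programme-sized); the readings R0–R6 are offered to the cell referee;
items 19618 / 19981 are NOT closed (their class statement — Kato's Conj. 12.10 lower inclusion at an additive
potentially supersingular prime — stays open off these rows: the LocIrr rows, the canonical-subgroup cells other than
`(5; II*)`, the rows with `μ² = 1`, the rows without a Steinberg prime `q ≢ ±1 (mod 5)`, everything at `p = 3`);
nothing is booked; BSD is not proved by any of this.

ROUTE-INDEPENDENT (lint `theses-cone`): this file imports neither the route file nor the route's Defs; the congruence binder
`IsCongruentModP p W G` of `…/Theorems/KatoDescentTamePotSupersingularDefs.lean` is repeated UNFOLDED (definitionally equal, so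
a consumer holding `hcong : IsCongruentModP p W G` passes it as is), and the (t′) binders come from the route-free
`Rank1Residual/Additive/SharpenedStatements.lean`.

References: [Fouquet2024CongruencesIMC] Thm 1.1 (p. 24), fibre (p. 29), Prop. 3.9 (p. 33), §4.2 (pp. 39–40);
[Nakamura2023ZetaMorphisms] Thm 1.1; [SkinnerUrban2014] Thm 3.6.4 (p. 43); [Kato2004Asterisque] §17.13 (pp. 279–280);
[Miller2011LMS] Def. 1.1.
-/

set_option autoImplicit false
-- sibling precedent (`KatoDescentTamePotSupersingularTameLowerFouquetRoadCited.lean`): the directory name repeats the summit name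
set_option linter.dupNamespace false

noncomputable section

open scoped Classical

namespace Summit.BirchSwinnertonDyer.BirchSwinnertonDyer.Theorems

open WeierstrassCurve Literature.NumberTheory.EllipticCurves
  Literature.NumberTheory.EllipticCurves.Rank1Residual
  Literature.NumberTheory.EllipticCurves.Rank1Residual.Typed
  Summit.BirchSwinnertonDyer.Rank1Residual.Additive
  Summit.BirchSwinnertonDyer.Rank1Residual

/-! ## §1 Per pair over fact (A): print shape, BSD_p, both halves, L₀ -/

section ShapeWitness

variable (W G : WeierstrassCurve ℚ) [W.IsElliptic] [W.IsGloballyMinimal] [G.IsElliptic] [G.IsGloballyMinimal]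
  (p : ℕ) [Fact p.Prime]

/-- **Bridge (definitional): fact (A)'s binders are the route's census predicates unfolded, its conclusion is
`PPartRankZero W p` unfolded.** For `W` of ANY reduction type at `p ≥ 5` with `ρ̄_{W,p}` onto, a multiplicative
`q ≠ p`, `q ≢ ±1 (mod p)`, with `p ∤ v_q(Δ_W)` (Skinner–Urban's (ram) for every fibre member), a congruent
good-ordinary `G` with `p ∤ a_p(G)² − 1` (shape witness; Thm 1.1 hyp. 2 = Nakamura (4)), `L(W,1) ≠ 0` and `Ш(W)`
finite: the print shape of the `p`-part of BSD in rank `0`. Conditional on the cite-level fact `hA`; nothing credited.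
[cite: Fouquet2024CongruencesIMC, Thm 1.1 (iv)⇒(ii) (p. 24) and Prop. 3.9 (p. 33)] [cite: SkinnerUrban2014, Thm 3.6.4 (p. 43)] -/
theorem pPartRankZero_of_fouquetFibreShape
    (hA : Fouquet2024.padicValRat_bsd_rank_zero_of_ordinaryFibre_ellipticShape) (hp : 5 ≤ p) (hsurj : Surj W p)
    (hram : ∃ ℓ : ℕ, ∃ _ : Fact ℓ.Prime, ℓ ≠ p ∧ W.HasMultiplicativeReductionAtPrime ℓ ∧
      ¬ p ∣ padicValInt ℓ W.minimalDiscriminantInt ∧ ¬ p ∣ ℓ - 1 ∧ ¬ p ∣ ℓ + 1)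
    (hord : GoodOrd G p) (hnak : ¬ (p : ℤ) ∣ (G.frobeniusTrace p) ^ 2 - 1)
    (hcong : ∀ ℓ : ℕ, ℓ.Prime → ¬ (ℓ ∣ p * W.conductorNorm ℤ * G.conductorNorm ℤ) →
      ((W.LFunction ℓ : ℤ) : ZMod p) = ((G.LFunction ℓ : ℤ) : ZMod p))
    (hL : W.entireLFunction 1 ≠ 0) (hfin : Finite W.sha) : PPartRankZero W p :=
  hA W G p hp hsurj hram hord.1 hord.2 hnak hcong hL hfin

/-- **Miller's `BSD(W,p)`** on the same rows, from fact (A) + modularity (`L(W,1) = L^{(0)}(W,1) ≠ 0`) + GZK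
(`Ш` finite, rank `0`), via `bsdp_of_pPartRankZero`. Conditional; nothing credited.
[cite: Fouquet2024CongruencesIMC, Prop. 3.9 (p. 33)] [cite: Miller2011LMS, Def. 1.1] -/
theorem bsdp_rankZero_of_fouquetFibreShape
    (hA : Fouquet2024.padicValRat_bsd_rank_zero_of_ordinaryFibre_ellipticShape) (hmod : hasEntireLFunction_rat)
    (hGZK : rank_eq_analyticRank_of_analyticRank_le_one) (hp : 5 ≤ p) (hr : W.analyticRank = 0)
    (hsurj : Surj W p)
    (hram : ∃ ℓ : ℕ, ∃ _ : Fact ℓ.Prime, ℓ ≠ p ∧ W.HasMultiplicativeReductionAtPrime ℓ ∧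
      ¬ p ∣ padicValInt ℓ W.minimalDiscriminantInt ∧ ¬ p ∣ ℓ - 1 ∧ ¬ p ∣ ℓ + 1)
    (hord : GoodOrd G p) (hnak : ¬ (p : ℤ) ∣ (G.frobeniusTrace p) ^ 2 - 1)
    (hcong : ∀ ℓ : ℕ, ℓ.Prime → ¬ (ℓ ∣ p * W.conductorNorm ℤ * G.conductorNorm ℤ) →
      ((W.LFunction ℓ : ℤ) : ZMod p) = ((G.LFunction ℓ : ℤ) : ZMod p)) :
    BSDp W p := by
  have hfin : Finite W.sha := (hGZK W (by omega)).2
  have hL : W.entireLFunction 1 ≠ 0 := by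
    rw [← W.leadingLCoeff_eq_of_analyticRank_eq_zero hr]
    exact W.leadingLCoeff_ne_zero_holds (hmod W)
  exact bsdp_of_pPartRankZero W p hmod hGZK hr
    (pPartRankZero_of_fouquetFibreShape W G p hA hp hsurj hram hord hnak hcong hL hfin)

/-- **Both typed halves `MissingPPartAt W p`** on the same rows (fact (A) + modularity + GZK). Conditional; nothing
credited. [cite: Fouquet2024CongruencesIMC, Thm 1.1 (p. 24) and Prop. 3.9 (p. 33)] [cite: Miller2011LMS, Def. 1.1] -/
theorem missingPPartAt_rankZero_of_fouquetFibreShape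
    (hA : Fouquet2024.padicValRat_bsd_rank_zero_of_ordinaryFibre_ellipticShape) (hmod : hasEntireLFunction_rat)
    (hGZK : rank_eq_analyticRank_of_analyticRank_le_one) (hp : 5 ≤ p) (hr : W.analyticRank = 0)
    (hsurj : Surj W p)
    (hram : ∃ ℓ : ℕ, ∃ _ : Fact ℓ.Prime, ℓ ≠ p ∧ W.HasMultiplicativeReductionAtPrime ℓ ∧
      ¬ p ∣ padicValInt ℓ W.minimalDiscriminantInt ∧ ¬ p ∣ ℓ - 1 ∧ ¬ p ∣ ℓ + 1)
    (hord : GoodOrd G p) (hnak : ¬ (p : ℤ) ∣ (G.frobeniusTrace p) ^ 2 - 1)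
    (hcong : ∀ ℓ : ℕ, ℓ.Prime → ¬ (ℓ ∣ p * W.conductorNorm ℤ * G.conductorNorm ℤ) →
      ((W.LFunction ℓ : ℤ) : ZMod p) = ((G.LFunction ℓ : ℤ) : ZMod p)) :
    MissingPPartAt W p := by
  haveI : Finite W.sha := (hGZK W (by omega)).2
  exact missingPPartAt_of_bsdp W p
    (bsdp_rankZero_of_fouquetFibreShape W G p hA hmod hGZK hp hr hsurj hram hord hnak hcong)

/-- **The crux's currency `MissingLowerBoundAt W p` (`ord_p #Ш_an ≤ ord_p #Ш`)** on the same rows — item 19981 /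
19618 restricted to the Fouquet-2024 shape-witness rows, from ONE cite-level fact + modularity + GZK. Conditional;
the items are NOT closed. [cite: Fouquet2024CongruencesIMC, Thm 1.1 (p. 24)] [cite: Miller2011LMS, Def. 1.1] -/
theorem missingLowerBoundAt_rankZero_of_fouquetFibreShape
    (hA : Fouquet2024.padicValRat_bsd_rank_zero_of_ordinaryFibre_ellipticShape) (hmod : hasEntireLFunction_rat)
    (hGZK : rank_eq_analyticRank_of_analyticRank_le_one) (hp : 5 ≤ p) (hr : W.analyticRank = 0)
    (hsurj : Surj W p)
    (hram : ∃ ℓ : ℕ, ∃ _ : Fact ℓ.Prime, ℓ ≠ p ∧ W.HasMultiplicativeReductionAtPrime ℓ ∧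
      ¬ p ∣ padicValInt ℓ W.minimalDiscriminantInt ∧ ¬ p ∣ ℓ - 1 ∧ ¬ p ∣ ℓ + 1)
    (hord : GoodOrd G p) (hnak : ¬ (p : ℤ) ∣ (G.frobeniusTrace p) ^ 2 - 1)
    (hcong : ∀ ℓ : ℕ, ℓ.Prime → ¬ (ℓ ∣ p * W.conductorNorm ℤ * G.conductorNorm ℤ) →
      ((W.LFunction ℓ : ℤ) : ZMod p) = ((G.LFunction ℓ : ℤ) : ZMod p)) :
    MissingLowerBoundAt W p :=
  (lower_and_upper_of_missingPPartAt W p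
    (missingPPartAt_rankZero_of_fouquetFibreShape W G p hA hmod hGZK hp hr hsurj hram hord hnak hcong)).1

end ShapeWitness

/-! ## §2 Row forms over fact (A) for the 19618 skeleton («FibreRowA») -/

/-- **L₀ on every (t′) rank-`0` row at `p ≥ 5` with `ρ̄` onto, a Steinberg prime `q ≢ ±1 (mod p)` of `W` with
`p ∤ v_q(Δ_W)`, and a congruent good-ordinary elliptic curve `G` with `p ∤ a_p(G)² − 1`** (displayed by
`GoodOrd ∧ (p ∤ a_p² − 1) ∧` the congruence of traces off `p N_W N_G` (= `IsCongruentModP p W G` unfolded) — NO Ass. 2.9 (2) binder, NO Ass. 3.4 binder on either curve, NO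
`Ram G`, NO tower: the Fouquet-2024 fibre road). The (t′) binders `Addv`/`SubTprime` are carried for the item's shape
and are idle in the proof (the fact is cell-free). Conditional on the cite-level fact `hA`; nothing credited; items NOT
closed. [cite: Fouquet2024CongruencesIMC, Thm 1.1 (iv)⇒(ii) (p. 24), Prop. 3.9 (p. 33)]
[cite: SkinnerUrban2014, Thm 3.6.4 (p. 43)] [cite: Miller2011LMS, Def. 1.1] -/
theorem tameLowerHalf_fouquetFibreShapeRows_of_fact
    (hA : Fouquet2024.padicValRat_bsd_rank_zero_of_ordinaryFibre_ellipticShape)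
    (hGZK : rank_eq_analyticRank_of_analyticRank_le_one) (hmod : hasEntireLFunction_rat) :
    ∀ (W : WeierstrassCurve ℚ) [W.IsElliptic] [W.IsGloballyMinimal] (p : ℕ) [Fact p.Prime],
      W.analyticRank = 0 → 5 ≤ p → Addv W p → SubTprime W p → Surj W p →
      (∃ ℓ : ℕ, ∃ _ : Fact ℓ.Prime, ℓ ≠ p ∧ W.HasMultiplicativeReductionAtPrime ℓ ∧
        ¬ p ∣ padicValInt ℓ W.minimalDiscriminantInt ∧ ¬ p ∣ ℓ - 1 ∧ ¬ p ∣ ℓ + 1) →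
      (∃ (G : WeierstrassCurve ℚ) (_ : G.IsElliptic) (_ : G.IsGloballyMinimal),
        GoodOrd G p ∧ ¬ (p : ℤ) ∣ (G.frobeniusTrace p) ^ 2 - 1 ∧
        (∀ ℓ : ℕ, ℓ.Prime → ¬ (ℓ ∣ p * W.conductorNorm ℤ * G.conductorNorm ℤ) →
          ((W.LFunction ℓ : ℤ) : ZMod p) = ((G.LFunction ℓ : ℤ) : ZMod p))) →
      MissingLowerBoundAt W p := by
  intro W _ _ p _ hr hp _ _ hsurj hram hG
  obtain ⟨G, hGe, hGm, hord, hnak, hcong⟩ := hG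
  exact missingLowerBoundAt_rankZero_of_fouquetFibreShape W G p hA hmod hGZK hp hr hsurj hram hord hnak hcong

/-- **Both halves (`MissingPPartAt`) on the same rows («FibreRowA»).** Conditional; nothing credited.
[cite: Fouquet2024CongruencesIMC, Prop. 3.9 (p. 33)] [cite: Miller2011LMS, Def. 1.1] -/
theorem tameMissingPPartAt_fouquetFibreShapeRows_of_fact
    (hA : Fouquet2024.padicValRat_bsd_rank_zero_of_ordinaryFibre_ellipticShape)
    (hGZK : rank_eq_analyticRank_of_analyticRank_le_one) (hmod : hasEntireLFunction_rat) :
    ∀ (W : WeierstrassCurve ℚ) [W.IsElliptic] [W.IsGloballyMinimal] (p : ℕ) [Fact p.Prime],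
      W.analyticRank = 0 → 5 ≤ p → Addv W p → SubTprime W p → Surj W p →
      (∃ ℓ : ℕ, ∃ _ : Fact ℓ.Prime, ℓ ≠ p ∧ W.HasMultiplicativeReductionAtPrime ℓ ∧
        ¬ p ∣ padicValInt ℓ W.minimalDiscriminantInt ∧ ¬ p ∣ ℓ - 1 ∧ ¬ p ∣ ℓ + 1) →
      (∃ (G : WeierstrassCurve ℚ) (_ : G.IsElliptic) (_ : G.IsGloballyMinimal),
        GoodOrd G p ∧ ¬ (p : ℤ) ∣ (G.frobeniusTrace p) ^ 2 - 1 ∧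
        (∀ ℓ : ℕ, ℓ.Prime → ¬ (ℓ ∣ p * W.conductorNorm ℤ * G.conductorNorm ℤ) →
          ((W.LFunction ℓ : ℤ) : ZMod p) = ((G.LFunction ℓ : ℤ) : ZMod p))) →
      MissingPPartAt W p := by
  intro W _ _ p _ hr hp _ _ hsurj hram hG
  obtain ⟨G, hGe, hGm, hord, hnak, hcong⟩ := hG
  exact missingPPartAt_rankZero_of_fouquetFibreShape W G p hA hmod hGZK hp hr hsurj hram hord hnak hcong

/-! ## §3 The SEED-FREE road over fact (B): the residual shape displayed on `W[p]|G_ℚₚ` -/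

section Line

variable (W : WeierstrassCurve ℚ) [W.IsElliptic] [W.IsGloballyMinimal] (p : ℕ) [Fact p.Prime]

/-- **Bridge (definitional) over fact (B): print shape of the `p`-part of BSD in rank `0` for `W` (any reduction at
`p ≥ 5`) with `ρ̄_{W,p}` onto, a Steinberg prime `q ≢ ±1 (mod p)` with `p ∤ v_q(Δ_W)`, and an ordinary residual line
at `p` with Nakamura's condition (`Fouquet2024.HasOrdinaryLineNakamuraAt p W`).** No partner, no Ass. 3.4.
Conditional on the cite-level fact `hB`; nothing credited.
[cite: Fouquet2024CongruencesIMC, Thm 1.1 (iv)⇒(ii) (p. 24) and Prop. 3.9 (p. 33)] [cite: Nakamura2023ZetaMorphisms, Thm 1.1 (4)(5)] -/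
theorem pPartRankZero_of_fouquetFibreLine
    (hB : Fouquet2024.padicValRat_bsd_rank_zero_of_ordinaryFibre) (hp : 5 ≤ p) (hsurj : Surj W p)
    (hram : ∃ ℓ : ℕ, ∃ _ : Fact ℓ.Prime, ℓ ≠ p ∧ W.HasMultiplicativeReductionAtPrime ℓ ∧
      ¬ p ∣ padicValInt ℓ W.minimalDiscriminantInt ∧ ¬ p ∣ ℓ - 1 ∧ ¬ p ∣ ℓ + 1)
    (hline : Fouquet2024.HasOrdinaryLineNakamuraAt p W) (hL : W.entireLFunction 1 ≠ 0)
    (hfin : Finite W.sha) : PPartRankZero W p :=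
  hB W p hp hsurj hram hline hL hfin

/-- **Both typed halves `MissingPPartAt W p` over fact (B)** (+ modularity + GZK), seed-free. Conditional; nothing
credited. [cite: Fouquet2024CongruencesIMC, Thm 1.1 (p. 24) and Prop. 3.9 (p. 33)] [cite: Miller2011LMS, Def. 1.1] -/
theorem missingPPartAt_rankZero_of_fouquetFibreLine
    (hB : Fouquet2024.padicValRat_bsd_rank_zero_of_ordinaryFibre) (hmod : hasEntireLFunction_rat)
    (hGZK : rank_eq_analyticRank_of_analyticRank_le_one) (hp : 5 ≤ p) (hr : W.analyticRank = 0)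
    (hsurj : Surj W p)
    (hram : ∃ ℓ : ℕ, ∃ _ : Fact ℓ.Prime, ℓ ≠ p ∧ W.HasMultiplicativeReductionAtPrime ℓ ∧
      ¬ p ∣ padicValInt ℓ W.minimalDiscriminantInt ∧ ¬ p ∣ ℓ - 1 ∧ ¬ p ∣ ℓ + 1)
    (hline : Fouquet2024.HasOrdinaryLineNakamuraAt p W) : MissingPPartAt W p := by
  haveI hfin : Finite W.sha := (hGZK W (by omega)).2
  have hL : W.entireLFunction 1 ≠ 0 := by
    rw [← W.leadingLCoeff_eq_of_analyticRank_eq_zero hr]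
    exact W.leadingLCoeff_ne_zero_holds (hmod W)
  exact missingPPartAt_of_bsdp W p
    (bsdp_of_pPartRankZero W p hmod hGZK hr (pPartRankZero_of_fouquetFibreLine W p hB hp hsurj hram hline hL hfin))

/-- **The crux's currency `MissingLowerBoundAt W p` over fact (B)**, seed-free. Conditional; items NOT closed.
[cite: Fouquet2024CongruencesIMC, Thm 1.1 (p. 24)] [cite: Miller2011LMS, Def. 1.1] -/
theorem missingLowerBoundAt_rankZero_of_fouquetFibreLine
    (hB : Fouquet2024.padicValRat_bsd_rank_zero_of_ordinaryFibre) (hmod : hasEntireLFunction_rat)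
    (hGZK : rank_eq_analyticRank_of_analyticRank_le_one) (hp : 5 ≤ p) (hr : W.analyticRank = 0)
    (hsurj : Surj W p)
    (hram : ∃ ℓ : ℕ, ∃ _ : Fact ℓ.Prime, ℓ ≠ p ∧ W.HasMultiplicativeReductionAtPrime ℓ ∧
      ¬ p ∣ padicValInt ℓ W.minimalDiscriminantInt ∧ ¬ p ∣ ℓ - 1 ∧ ¬ p ∣ ℓ + 1)
    (hline : Fouquet2024.HasOrdinaryLineNakamuraAt p W) : MissingLowerBoundAt W p :=
  (lower_and_upper_of_missingPPartAt W p
    (missingPPartAt_rankZero_of_fouquetFibreLine W p hB hmod hGZK hp hr hsurj hram hline)).1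

end Line

/-- **Row form over fact (B) for the 19618 skeleton («FibreRowB», SEED-FREE, CLASS-LEVEL): L₀ on every (t′)
rank-`0` row at `p ≥ 5` with `ρ̄` onto, a Steinberg prime `q ≢ ±1 (mod p)` with `p ∤ v_q(Δ_W)`, and an ordinary
residual line at `p` with Nakamura's condition.** On the cell `(5; II*, v₅(c₄) = 4)` the last binder is decided per row by
the factorisation type `2 + 10` of the `5`-division polynomial over `ℚ₅` (kit j274275; displayed, not kernel).
Conditional on the cite-level fact `hB`; nothing credited; items NOT closed.
[cite: Fouquet2024CongruencesIMC, Thm 1.1 (iv)⇒(ii) (p. 24), Prop. 3.9 (p. 33), §4.2 (p. 39)]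
[cite: SkinnerUrban2014, Thm 3.6.4 (p. 43)] [cite: Miller2011LMS, Def. 1.1] -/
theorem tameLowerHalf_fouquetFibreLineRows_of_fact
    (hB : Fouquet2024.padicValRat_bsd_rank_zero_of_ordinaryFibre)
    (hGZK : rank_eq_analyticRank_of_analyticRank_le_one) (hmod : hasEntireLFunction_rat) :
    ∀ (W : WeierstrassCurve ℚ) [W.IsElliptic] [W.IsGloballyMinimal] (p : ℕ) [Fact p.Prime],
      W.analyticRank = 0 → 5 ≤ p → Addv W p → SubTprime W p → Surj W p →
      (∃ ℓ : ℕ, ∃ _ : Fact ℓ.Prime, ℓ ≠ p ∧ W.HasMultiplicativeReductionAtPrime ℓ ∧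
        ¬ p ∣ padicValInt ℓ W.minimalDiscriminantInt ∧ ¬ p ∣ ℓ - 1 ∧ ¬ p ∣ ℓ + 1) →
      Fouquet2024.HasOrdinaryLineNakamuraAt p W → MissingLowerBoundAt W p := by
  intro W _ _ p _ hr hp _ _ hsurj hram hline
  exact missingLowerBoundAt_rankZero_of_fouquetFibreLine W p hB hmod hGZK hp hr hsurj hram hline

/-- **Both halves (`MissingPPartAt`) on the same rows («FibreRowB», seed-free).** Conditional; nothing credited.
[cite: Fouquet2024CongruencesIMC, Prop. 3.9 (p. 33)] [cite: Miller2011LMS, Def. 1.1] -/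
theorem tameMissingPPartAt_fouquetFibreLineRows_of_fact
    (hB : Fouquet2024.padicValRat_bsd_rank_zero_of_ordinaryFibre)
    (hGZK : rank_eq_analyticRank_of_analyticRank_le_one) (hmod : hasEntireLFunction_rat) :
    ∀ (W : WeierstrassCurve ℚ) [W.IsElliptic] [W.IsGloballyMinimal] (p : ℕ) [Fact p.Prime],
      W.analyticRank = 0 → 5 ≤ p → Addv W p → SubTprime W p → Surj W p →
      (∃ ℓ : ℕ, ∃ _ : Fact ℓ.Prime, ℓ ≠ p ∧ W.HasMultiplicativeReductionAtPrime ℓ ∧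
        ¬ p ∣ padicValInt ℓ W.minimalDiscriminantInt ∧ ¬ p ∣ ℓ - 1 ∧ ¬ p ∣ ℓ + 1) →
      Fouquet2024.HasOrdinaryLineNakamuraAt p W → MissingPPartAt W p := by
  intro W _ _ p _ hr hp _ _ hsurj hram hline
  exact missingPPartAt_rankZero_of_fouquetFibreLine W p hB hmod hGZK hp hr hsurj hram hline

end Summit.BirchSwinnertonDyer.BirchSwinnertonDyer.Theorems

end
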